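import Mathlib
import HarnessLib
import Summits.HubbardSuperconductivity.HubbardSuperconductivity.Theorems.KLProgrammeKLRegimeTwoVolumeLipGluedWt
import Summits.HubbardSuperconductivity.HubbardSuperconductivity.Theorems.KLProgrammeKLRegimeTwoVolumeLipDeepFirstOrder
import Summits.HubbardSuperconductivity.HubbardSuperconductivity.Theorems.KLProgrammeKLRegimeEngineTowerBlockIncrWt
import Summits.HubbardSuperconductivity.HubbardSuperconductivity.Theorems.KLProgrammeKLRegimeWickEffectiveActionLegDressing
import Summits.HubbardSuperconductivity.HubbardSuperconductivity.Theorems.KLProgrammeKLRegimeTwoVolumeLipDiffDefsOwnFrames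

/-!
# Route `KLProgramme` — crux K3 ENGINE (stmt-HubbardSuperconductivity-20437), stub (e) proof-input «(e)-D-ROWS», F-D4b AT A FREE WEIGHT RATE, OWN FRAMES:
# the deep block-step door of `…TwoVolumeLipBlockStepDeepRate` (p721878) RE-KEYED with the coarse objects in frame `K₁` and the fine objects in frame `K₂`
# (seat hubbard-kl-k3c4-p1 g25, VL lane; `--supports` 20437; located design point #8 «FRAMES», memo DROWS-SCOPE-g25.md §13.16 option (A), g25/REKEY-A.md file 1)

* **`lipBlockStep_deep_rate_le₂`** — verbatim `lipBlockStep_deep_rate_le` with `klLipInput L … K₁`, every fine-volume object (`hubbardCovSliceCT (bL) … K₂`, the fat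
  multiplier / analysis matrices at `nambuXiCT (bL) μ K₂`, `klAnisoFamily (bL) … K₂`) at `K₂`, and the measured difference `klLipInputDiff₂ L b M β U μ K₁ K₂ d k`
  (`…TwoVolumeLipDiffDefsOwnFrames`); tokens `Z^{K₂}_{bL} ≠ 0`, `Z^{K₁}_{L} ≠ 0`.  The proof is the common-frame proof with the frames placed by volume (the door only ever
  uses fine-frame doors and the glued coarse element as data).
Nothing about the model is asserted beyond the hypotheses; nothing asserts the (D) rows, stub (e), VL, K3 or superconductivity.
References: BGM 2006 §2.8, §3 (3.2)–(3.8) [cite: BenfattoGiulianiMastropietro2006].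
-/

noncomputable section

namespace Summit.HubbardSuperconductivity.HubbardSuperconductivity.Theorems.TwoVolumeLip

set_option linter.dupNamespace false -- summit = problem name (single-conjunct summit), D-0017

open Finset Literature.MathematicalPhysics.QuantumLattice GrassmannAlgebra Literature.Probability.LatticeModels
  Literature.Probability.LatticeModels.BattleFederbush
open Literature.MathematicalPhysics.QuantumLattice.FermiRG
open Summit.HubbardSuperconductivity.HubbardSuperconductivity.Theorems.KLRegimeSplit
open Summit.HubbardSuperconductivity.HubbardSuperconductivity.Theorems.KLProgrammeLegKernels
open Summit.HubbardSuperconductivity.HubbardSuperconductivity.Theorems.DispersionFlow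
open Summit.HubbardSuperconductivity.HubbardSuperconductivity.Theorems.EngineV8
open Summit.HubbardSuperconductivity.HubbardSuperconductivity.Theorems.TwoVolumeSource
open Summit.HubbardSuperconductivity.HubbardSuperconductivity.Theorems.TwoVolumeDefect

variable {L b M : ℕ} [NeZero L] [NeZero (b * L)] [NeZero M]

/-- **THE DEEP BLOCK-STEP DOOR OF THE TWO-VOLUME LIPSCHITZ TOWER AT THE MODEL OBJECTS, FREE WEIGHT RATE** (block `k`, `1 ≤ dk`, fine torus `bL`, coarse `L`,
common frame `K`, glued weight at ANY rate `j_w`, deep region `klDeepPins L R`, near input pins `(R+R′)`-deep, `0 < Λ ≤ 1 + Λ_{j_w}(R′+1)`).  `j_w := dk−1` is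
`lipBlockStep_deep_le`; the partition functions `Z^K_{bL,Λ_{dk}}, Z^K_{L,Λ_{dk}} ≠ 0` discharge parity and constant parts. -/
theorem lipBlockStep_deep_rate_le₂ {β : ℝ} (hβ : 0 < β) (U μ : ℝ) (K₁ K₂ : TrigPolyC4v) {d k jw : ℕ}
    (hZf : hubbardEffPartitionFnCT (b * L) M β U μ 0 K₂ (klScale klE0 (d * k)) ≠ 0)
    (hZc : hubbardEffPartitionFnCT L M β U μ 0 K₁ (klScale klE0 (d * k)) ≠ 0)
    {κ : ℝ} (hκ : 0 < κ) (hGB : IsGramBoundedR ((sectorSubMatrix (b * L) M β (bgmFatMultiplier (b * L) M klE0 β (nambuXiCT (b * L) μ K₂) (d * k - 1))).transpose * hubbardCovSliceCT (b * L) M β μ 0 K₂ (klScale klE0 (d * (k + 1))) (klScale klE0 (d * k)) * sectorSubMatrix (b * L) M β (bgmFatMultiplier (b * L) M klE0 β (nambuXiCT (b * L) μ K₂) (d * k - 1))) κ)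
    (NV ND E : ℕ → ℝ) (hNV0 : ∀ m', 0 ≤ NV m') (hND0 : ∀ m', 0 ≤ ND m') (hE0 : ∀ m', 0 ≤ E m')
    (hNV : ∀ m' (j : Fin (2 * m')) (x : (SpaceTimeIdx (b * L) M × SectorLeg (sectorCount (d * k - 1)))), ∑ Y ∈ univ.filter (fun Y : Fin (2 * m') → (SpaceTimeIdx (b * L) M × SectorLeg (sectorCount (d * k - 1))) => Y j = x),
      ‖kernel ℂ (klGlue L b M (sectorCount (d * k - 1)) (klLipInput L M β U μ K₁ d k)) (2 * m') Y‖ * klGluedWt L b M β jw (sectorCount (d * k - 1)) (univ.image Y) ≤ NV m')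
    (hND : ∀ m' (j : Fin (2 * m')) (x : (SpaceTimeIdx (b * L) M × SectorLeg (sectorCount (d * k - 1)))), ∑ Y ∈ univ.filter (fun Y : Fin (2 * m') → (SpaceTimeIdx (b * L) M × SectorLeg (sectorCount (d * k - 1))) => Y j = x),
      ‖kernel ℂ (klLipInputDiff₂ L b M β U μ K₁ K₂ d k) (2 * m') Y‖ * klGluedWt L b M β jw (sectorCount (d * k - 1)) (univ.image Y) ≤ ND m')
    (R R' : ℕ)
    (hE : ∀ m' (j : Fin (2 * m')) (x : (SpaceTimeIdx (b * L) M × SectorLeg (sectorCount (d * k - 1)))), x ∈ klDeepPins L R →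
      ∑ Y ∈ univ.filter (fun Y : Fin (2 * m') → (SpaceTimeIdx (b * L) M × SectorLeg (sectorCount (d * k - 1))) => Y j = x), ‖kernel ℂ (klLipInputDiff₂ L b M β U μ K₁ K₂ d k) (2 * m') Y‖ ≤ E m')
    {α : ℝ} (hα : 0 < α)
    (hrow : ∀ X, ∑ Y, ‖((sectorSubMatrix (b * L) M β (bgmFatMultiplier (b * L) M klE0 β (nambuXiCT (b * L) μ K₂) (d * k - 1))).transpose * hubbardCovSliceCT (b * L) M β μ 0 K₂ (klScale klE0 (d * (k + 1))) (klScale klE0 (d * k)) * sectorSubMatrix (b * L) M β (bgmFatMultiplier (b * L) M klE0 β (nambuXiCT (b * L) μ K₂) (d * k - 1))) X Y‖ * klGluedWt L b M β jw (sectorCount (d * k - 1)) {X, Y} ≤ α)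
    (hcol : ∀ Y, ∑ X, ‖((sectorSubMatrix (b * L) M β (bgmFatMultiplier (b * L) M klE0 β (nambuXiCT (b * L) μ K₂) (d * k - 1))).transpose * hubbardCovSliceCT (b * L) M β μ 0 K₂ (klScale klE0 (d * (k + 1))) (klScale klE0 (d * k)) * sectorSubMatrix (b * L) M β (bgmFatMultiplier (b * L) M klE0 β (nambuXiCT (b * L) μ K₂) (d * k - 1))) X Y‖ * klGluedWt L b M β jw (sectorCount (d * k - 1)) {X, Y} ≤ α)
    {ρ : ℝ} (hρ : 0 < ρ)
    (hθ₁ : Real.exp 1 * α * normV (SpaceTimeIdx (b * L) M × SectorLeg (sectorCount (d * k - 1))) κ ρ (fun m' => NV m' + ND m' + E m') / κ ^ 2 < 1)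
    (hθ₂ : Real.exp 1 * α * normV (SpaceTimeIdx (b * L) M × SectorLeg (sectorCount (d * k - 1))) κ ρ (fun m' => NV m' + ND m') / κ ^ 2 < 1)
    {N₀ : ℕ} (hN₀ : 2 ≤ N₀)
    (Near : (SpaceTimeIdx (b * L) M × SectorLeg (sectorCount (d * k - 1))) → Prop) [DecidablePred Near] (hNear : ∀ y', Near y' → y' ∈ klDeepPins L (R + R'))
    {a τ : ℝ} (ha : 0 ≤ a)
    (hcolH : ∀ y', ∑ x'', ‖(((((imagTimeWeight β M : ℝ) : ℂ)) • sectorAnalysisMatrix (b * L) M β (klAnisoFamily (b * L) M β μ K₂ klE0 (d * k))) * sectorSubMatrix (b * L) M β (bgmFatMultiplier (b * L) M klE0 β (nambuXiCT (b * L) μ K₂) (d * k - 1))) x'' y'‖ ≤ a) (w'' : SpaceTimeIdx (b * L) M × SectorLeg (sectorCount (d * k)))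
    (hrowH : ∑ y' ∈ univ.filter (fun y' : (SpaceTimeIdx (b * L) M × SectorLeg (sectorCount (d * k - 1))) => Near y'), ‖(((((imagTimeWeight β M : ℝ) : ℂ)) • sectorAnalysisMatrix (b * L) M β (klAnisoFamily (b * L) M β μ K₂ klE0 (d * k))) * sectorSubMatrix (b * L) M β (bgmFatMultiplier (b * L) M klE0 β (nambuXiCT (b * L) μ K₂) (d * k - 1))) w'' y'‖ ≤ a)
    (hτH : ∑ y' ∈ univ.filter (fun y' : (SpaceTimeIdx (b * L) M × SectorLeg (sectorCount (d * k - 1))) => ¬ Near y'), ‖(((((imagTimeWeight β M : ℝ) : ℂ)) • sectorAnalysisMatrix (b * L) M β (klAnisoFamily (b * L) M β μ K₂ klE0 (d * k))) * sectorSubMatrix (b * L) M β (bgmFatMultiplier (b * L) M klE0 β (nambuXiCT (b * L) μ K₂) (d * k - 1))) w'' y'‖ ≤ τ)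
    {Λ : ℝ} (hΛ0 : 0 < Λ) (hΛle : Λ ≤ 1 + klScale klE0 jw * ((R' : ℝ) + 1))
    {q : ℕ} (i : Fin (2 * q)) :
    ∑ X'' ∈ univ.filter (fun X'' : Fin (2 * q) → SpaceTimeIdx (b * L) M × SectorLeg (sectorCount (d * k)) => X'' i = w''),
        ‖kernel ℂ (ExteriorAlgebra.map (Matrix.toLin' ((((imagTimeWeight β M : ℝ) : ℂ)) • sectorAnalysisMatrix (b * L) M β (klAnisoFamily (b * L) M β μ K₂ klE0 (d * k))))
          ((effAction ℂ (hubbardCovSliceCT (b * L) M β μ 0 K₂ (klScale klE0 (d * (k + 1))) (klScale klE0 (d * k))) (ExteriorAlgebra.map (Matrix.toLin' (sectorSubMatrix (b * L) M β (bgmFatMultiplier (b * L) M klE0 β (nambuXiCT (b * L) μ K₂) (d * k - 1)))) (klLipInput (b * L) M β U μ K₂ d k)) - ExteriorAlgebra.map (Matrix.toLin' (sectorSubMatrix (b * L) M β (bgmFatMultiplier (b * L) M klE0 β (nambuXiCT (b * L) μ K₂) (d * k - 1)))) (klLipInput (b * L) M β U μ K₂ d k)) -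
            (effAction ℂ (hubbardCovSliceCT (b * L) M β μ 0 K₂ (klScale klE0 (d * (k + 1))) (klScale klE0 (d * k))) (ExteriorAlgebra.map (Matrix.toLin' (sectorSubMatrix (b * L) M β (bgmFatMultiplier (b * L) M klE0 β (nambuXiCT (b * L) μ K₂) (d * k - 1)))) (klGlue L b M (sectorCount (d * k - 1)) (klLipInput L M β U μ K₁ d k))) - ExteriorAlgebra.map (Matrix.toLin' (sectorSubMatrix (b * L) M β (bgmFatMultiplier (b * L) M klE0 β (nambuXiCT (b * L) μ K₂) (d * k - 1)))) (klGlue L b M (sectorCount (d * k - 1)) (klLipInput L M β U μ K₁ d k))))) (2 * q) X''‖ ≤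
      a ^ (2 * q - 1) * (a *
        ((∑ m' ∈ range (Fintype.card (SpaceTimeIdx (b * L) M × SectorLeg (sectorCount (d * k - 1))) / 2 + 1), if q < m' then ((2 * m').choose (2 * q) : ℝ) * κ ^ (2 * m' - 2 * q) * E m' else 0) +
          Λ⁻¹ * ∑ m' ∈ range (Fintype.card (SpaceTimeIdx (b * L) M × SectorLeg (sectorCount (d * k - 1))) / 2 + 1),
            if q < m' then ((2 * m').choose (2 * q) : ℝ) * κ ^ (2 * m' - 2 * q) * ND m' else 0) +
        τ * ∑ m' ∈ range (Fintype.card (SpaceTimeIdx (b * L) M × SectorLeg (sectorCount (d * k - 1))) / 2 + 1), if q < m' then ((2 * m').choose (2 * q) : ℝ) * κ ^ (2 * m' - 2 * q) * ND m' else 0) +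
      a ^ (2 * q - 1) * (a *
        ((∑ n ∈ Ico 2 N₀, (ρ⁻¹ ^ (2 * q) * κ⁻¹ ^ (2 * (n - 1)) * (α ^ (n - 1) * Real.exp n)) *
            ∑ δ ∈ (Fintype.piFinset fun _ : Fin n => range (Fintype.card (SpaceTimeIdx (b * L) M × SectorLeg (sectorCount (d * k - 1))) / 2 + 1)) with 2 * q + 2 * (n - 1) ≤ ∑ a, 2 * δ a,
              ∑ a, (Real.exp 2 * (κ + ρ)) ^ (2 * δ a) * E (δ a) *
                ∏ b ∈ univ.erase a, (Real.exp 2 * (κ + ρ)) ^ (2 * δ b) * (NV (δ b) + ND (δ b) + E (δ b)) +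
          2 * (ρ⁻¹ ^ (2 * q) * (Real.exp 1 * normV (SpaceTimeIdx (b * L) M × SectorLeg (sectorCount (d * k - 1))) κ ρ (fun m' => NV m' + ND m' + E m')) *
            (Real.exp 1 * α * normV (SpaceTimeIdx (b * L) M × SectorLeg (sectorCount (d * k - 1))) κ ρ (fun m' => NV m' + ND m' + E m') / κ ^ 2) ^ (N₀ - 1) /
              (1 - Real.exp 1 * α * normV (SpaceTimeIdx (b * L) M × SectorLeg (sectorCount (d * k - 1))) κ ρ (fun m' => NV m' + ND m' + E m') / κ ^ 2))) +
        Λ⁻¹ * (∑ n ∈ Ico 2 N₀, (ρ⁻¹ ^ (2 * q) * κ⁻¹ ^ (2 * (n - 1)) * (α ^ (n - 1) * Real.exp n)) *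
            ∑ δ ∈ (Fintype.piFinset fun _ : Fin n => range (Fintype.card (SpaceTimeIdx (b * L) M × SectorLeg (sectorCount (d * k - 1))) / 2 + 1)) with 2 * q + 2 * (n - 1) ≤ ∑ a, 2 * δ a,
              ∑ a, (Real.exp 2 * (κ + ρ)) ^ (2 * δ a) * ND (δ a) *
                ∏ b ∈ univ.erase a, (Real.exp 2 * (κ + ρ)) ^ (2 * δ b) * (NV (δ b) + ND (δ b)) +
          Λ * (2 * (ρ⁻¹ ^ (2 * q) * (Real.exp 1 * normV (SpaceTimeIdx (b * L) M × SectorLeg (sectorCount (d * k - 1))) κ ρ (fun m' => NV m' + ND m')) *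
            (Real.exp 1 * α * normV (SpaceTimeIdx (b * L) M × SectorLeg (sectorCount (d * k - 1))) κ ρ (fun m' => NV m' + ND m') / κ ^ 2) ^ (N₀ - 1) /
              (1 - Real.exp 1 * α * normV (SpaceTimeIdx (b * L) M × SectorLeg (sectorCount (d * k - 1))) κ ρ (fun m' => NV m' + ND m') / κ ^ 2))))) +
        τ * (∑ n ∈ Ico 2 N₀, (ρ⁻¹ ^ (2 * q) * κ⁻¹ ^ (2 * (n - 1)) * (α ^ (n - 1) * Real.exp n)) *
            ∑ δ ∈ (Fintype.piFinset fun _ : Fin n => range (Fintype.card (SpaceTimeIdx (b * L) M × SectorLeg (sectorCount (d * k - 1))) / 2 + 1)) with 2 * q + 2 * (n - 1) ≤ ∑ a, 2 * δ a,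
              ∑ a, (Real.exp 2 * (κ + ρ)) ^ (2 * δ a) * ND (δ a) *
                ∏ b ∈ univ.erase a, (Real.exp 2 * (κ + ρ)) ^ (2 * δ b) * (NV (δ b) + ND (δ b)) +
          2 * (ρ⁻¹ ^ (2 * q) * (Real.exp 1 * normV (SpaceTimeIdx (b * L) M × SectorLeg (sectorCount (d * k - 1))) κ ρ (fun m' => NV m' + ND m')) *
            (Real.exp 1 * α * normV (SpaceTimeIdx (b * L) M × SectorLeg (sectorCount (d * k - 1))) κ ρ (fun m' => NV m' + ND m') / κ ^ 2) ^ (N₀ - 1) /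
              (1 - Real.exp 1 * α * normV (SpaceTimeIdx (b * L) M × SectorLeg (sectorCount (d * k - 1))) κ ρ (fun m' => NV m' + ND m') / κ ^ 2)))) := by
  classical
  -- parity and constant parts of the two inputs
  have hDLe : klLipInput L M β U μ K₁ d k ∈ evenOdd ℂ 0 :=
    klLipInput_mem_evenOdd_zero (Summit.HubbardSuperconductivity.HubbardSuperconductivity.Theorems.KLRegimeWick.klEffectiveAction_mem_evenOdd_zero β U μ K₁ klE0 (d * k))
  have hDL0 : constPart ℂ (klLipInput L M β U μ K₁ d k) = 0 := by
    rw [constPart_klLipInput]; exact constPart_klEffectiveAction_eq_zero β U μ K₁ klE0 (d * k) hZc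
  have hVe : klGlue L b M (sectorCount (d * k - 1)) (klLipInput L M β U μ K₁ d k) ∈ evenPart ℂ (SpaceTimeIdx (b * L) M × SectorLeg (sectorCount (d * k - 1))) := klGlue_mem_evenOdd_zero hDLe
  have hV0 : constPart ℂ (klGlue L b M (sectorCount (d * k - 1)) (klLipInput L M β U μ K₁ d k)) = 0 := constPart_klGlue hDL0
  have hDe : klLipInputDiff₂ L b M β U μ K₁ K₂ d k ∈ evenPart ℂ (SpaceTimeIdx (b * L) M × SectorLeg (sectorCount (d * k - 1))) :=
    klLipInputDiff₂_mem_evenOdd_zero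
      (Summit.HubbardSuperconductivity.HubbardSuperconductivity.Theorems.KLRegimeWick.klEffectiveAction_mem_evenOdd_zero β U μ K₂ klE0 (d * k))
      (Summit.HubbardSuperconductivity.HubbardSuperconductivity.Theorems.KLRegimeWick.klEffectiveAction_mem_evenOdd_zero β U μ K₁ klE0 (d * k))
  have hD0 : constPart ℂ (klLipInputDiff₂ L b M β U μ K₁ K₂ d k) = 0 :=
    constPart_klLipInputDiff₂ (constPart_klEffectiveAction_eq_zero β U μ K₂ klE0 (d * k) hZf) (constPart_klEffectiveAction_eq_zero β U μ K₁ klE0 (d * k) hZc)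
  -- the glued weight and the admissible constant
  have hwt : IsTreeWeight (klGluedWt L b M β jw (sectorCount (d * k - 1))) := isTreeWeight_klGluedWt hβ.le _ _
  have hΛ : ∀ y', Near y' → ∀ Sset : Finset (SpaceTimeIdx (b * L) M × SectorLeg (sectorCount (d * k - 1))), y' ∈ Sset → (∃ z ∈ Sset, ¬ z ∈ klDeepPins L R) →
      Λ ≤ klGluedWt L b M β jw (sectorCount (d * k - 1)) Sset := by
    intro y' hy' Sset hyS hz
    obtain ⟨z, hzS, hzR⟩ := hz
    exact hΛle.trans (klGluedWt_ge_of_deep_of_not_deep hβ.le jw hyS hzS (hNear y' hy') hzR)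
  -- the substitutions
  set f : ((SpaceTimeIdx (b * L) M × SectorLeg (sectorCount (d * k - 1))) → ℂ) →ₗ[ℂ] (HubbardFieldIdx (b * L) M → ℂ) := Matrix.toLin' (sectorSubMatrix (b * L) M β (bgmFatMultiplier (b * L) M klE0 β (nambuXiCT (b * L) μ K₂) (d * k - 1))) with hf
  set g : (HubbardFieldIdx (b * L) M → ℂ) →ₗ[ℂ] (SpaceTimeIdx (b * L) M × SectorLeg (sectorCount (d * k)) → ℂ) := Matrix.toLin' ((((imagTimeWeight β M : ℝ) : ℂ)) • sectorAnalysisMatrix (b * L) M β (klAnisoFamily (b * L) M β μ K₂ klE0 (d * k))) with hg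
  have hfm : LinearMap.toMatrix' f = sectorSubMatrix (b * L) M β (bgmFatMultiplier (b * L) M klE0 β (nambuXiCT (b * L) μ K₂) (d * k - 1)) := by rw [hf, LinearMap.toMatrix'_toLin']
  have hgf : LinearMap.toMatrix' (g ∘ₗ f) = ((((imagTimeWeight β M : ℝ) : ℂ)) • sectorAnalysisMatrix (b * L) M β (klAnisoFamily (b * L) M β μ K₂ klE0 (d * k))) * sectorSubMatrix (b * L) M β (bgmFatMultiplier (b * L) M klE0 β (nambuXiCT (b * L) μ K₂) (d * k - 1)) := by
    rw [LinearMap.toMatrix'_comp, hg, hf, LinearMap.toMatrix'_toLin', LinearMap.toMatrix'_toLin']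
  have h := sum_pinned_norm_kernel_map_born_sub_born_le_of_deep hwt (hubbardCovSliceCT (b * L) M β μ 0 K₂ (klScale klE0 (d * (k + 1))) (klScale klE0 (d * k))) f g hκ (by rw [hfm]; exact hGB)
    (klGlue L b M (sectorCount (d * k - 1)) (klLipInput L M β U μ K₁ d k)) (klLipInputDiff₂ L b M β U μ K₁ K₂ d k) hVe hDe hV0 hD0 NV ND E hNV0 hND0 hE0 hNV hND (fun x => x ∈ klDeepPins L R) (fun m' j x hx => hE m' j x hx) hα
    (by rw [hfm]; exact hrow) (by rw [hfm]; exact hcol) hρ hθ₁ hθ₂ hN₀ Near (a := a) (τ := τ) ha (by rw [hgf]; exact hcolH) w''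
    (by rw [hgf]; exact hrowH) (by rw [hgf]; exact hτH) hΛ0 hΛ i
  rw [← klLipInput_fine_eq₂] at h
  exact h

end Summit.HubbardSuperconductivity.HubbardSuperconductivity.Theorems.TwoVolumeLip

end
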